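import Summits.QuantumFields.YangMills.Theorems.BalabanUVNodesN19ModellingLetterOfPeierlsDomination

/-!
# BalabanUVNodes ∕ node N19 (NE7) — THE BIRTH LETTER FROM AN OVER-AGED COVER: the (V‑a) side of idea-3's hellinger road on ONE weight system per `(K,t)`,
# stated at the class-weight level of the road's sockets (p618979 ∕ p622199 ∕ p627322), `C₀ = 1`

Cell `pub-ymgap` (HUMAN RULING D-0062 Track A ∕ director-ym R399 (3a) second-wave width seats), WIDTH SEAT `pub-ymgap-dag-n19-w4` (node n19 = NE7),
generation g8, CLAIM-3 ∕ INTENT-3.  Key item K3⁸ `SpineGivenEndpointR13SepCoPHV` (stmt-QuantumFields-27366, skeleton v6 b4e55110ab73e679, stub 2 `stub_expansion13HV`;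
Params-free ⇒ version-free); filed `--kind proof --supports … --as helper`.  COUNT-NEUTRAL.  THEOREMS ONLY (0 `def`, 0 `instance`, 0 `notation`, 0 `sorry`).
ADDITIVE — imports this seat's g7 p623281 `…N19ModellingLetterOfPeierlsDomination` ONLY (through it dag-n20-w5's p621610 ∕ p622199); modifies nothing.

WHY.  p623281 compiles the (V‑a) side of the road down to FOUR letters per `(K,t)` — (KR‑dc), (PEND), (POS) and (BIRTH) — where (BIRTH) is a union bound
`wild ≤ C₀·Σ_{m<M} 𝟙[x ≤ m]·Σ_{p∈Pos m} (Σ_{X∈𝒜 m p, Over} A m p X)∕(Σ_{𝒜 m p} A m p)` over birth data `(m,p)` with a density constant `C₀` and a SEPARATE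
weight system `(𝒜 m p, A m p)` per datum, and `wild` is an abstract number.  At the level where the road's sockets live (p618979 ∕ p627322
`affinityDefectLetter_of_tameTilt(s)`, p622199 `classWildMass_summable_of_refreshProcess`) the wild mass is CONCRETE: `wild = Σ_{W K t} A ∕ Σ_{T K} A`, one
run's class law of the wild class set.  In idea-3's reading (memo `OVERAGE-RATE-READING-idea3-g13.md` §1∕§3(e): «classes carrying an OVER-AGED pending
large-field region … regions born `m` steps above the key have `vol·L^{4m}` positions») the wild classes are exactly the classes over-aged at SOME birth datum,
and the per-datum relative masses are masses under the SAME class law.  THIS FILE states that edition: ONE finite class set `T` of histories (refresh-event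
sets, DOWN-CLOSED), ONE weight `A ≥ 0` with the deficit factorisation (KR‑dc) (depth-indexed factors, as p623281 asks them), (PEND) per datum on the same
system, (POS), and instead of (BIRTH) the COVER letter «every wild class is over-aged at some datum `(m,p)`, `x ≤ m < M`, `p ∈ Pos m`» ⇒ (BIRTH) holds with
`C₀ = 1` by the union bound (§1), hence `hmodel` (§2), hence — through p623281 §3 BY NAME — EXACTLY the wild-mass block `(wm, hwm, hwild, hws)` of the
road's K-summation for the class weights themselves (§3).  One weight system, no density constant, no abstract `wild`.
* §1 ★ `relMass_le_sum_relOveraged_of_cover` [folklore union bound]: `A ≥ 0` on `T`, `W ⊆ T` covered ⇒ `Σ_W A∕Σ_T A ≤ 1·Σ_m 𝟙[x ≤ m] Σ_{p} (Σ_{T, Over m p} A)∕(Σ_T A)`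
  — LITERALLY p623281's `hbirth` with `𝒜 m p := T`, `A m p := A`, `C₀ := 1`; `relMass_le_one`.
* §2 ★★ `modellingLetter_of_coverLetters` (ONE `(K,t)`: (KR‑dc) + (PEND) + (POS) + COVER on ONE system ⇒ p621610's `hmodel` with `C₀ = 1`; p623281 §1 BY NAME).
* §3 ★★★ `classWildMass_summable_of_coverLetters` (ALONG `K`: + p621610's factor ∕ price ∕ rate ∕ entropy letters, `κ₁(θ−Λ−ζ) > 2` ⇒
  `∃ wm ≥ 0, Σ√wm_K < ∞, Σ_{W K t} A∕Σ_{T K} A ≤ wm_K` — the `(wm, hwm, hwildA, hws)` binders of p627322 `affinityDefectLetter_of_tameTilt` ∕ p618979, with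
  `ι := Finset α`; p623281 `wildMass_summable_of_peierlsLetters` BY NAME) · `classWildMass_summableOne_of_coverLetters` (exponent 1, window-key-core's (AC)).
* §4 `toy_cover_tight` (A6: one class over-aged at the one datum — §1 holds with equality `1 ≤ 1·1`).
CREDIT.  The refresh process and the reading: idea-3 g13∕g14; p621610 ∕ p622199: dag-n20-w5 g4; the Peierls composition p623281: this seat g7; CRIT-1 g6 (C4, N7).
New here: only the cover ⇒ birth bookkeeping and the one-system restatement.

HONEST FRAMING.  [folklore] finite sums on HYPOTHESIS SHAPES.  EVERY letter — the down-closed class family with nonnegative weights and the deficit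
factorisation (KR‑dc) (idea-3's READING of [LF‑II] (1.79)–(1.83), typable against the datum only once a skeleton exposes keyed carriers at the window key),
the pendency containment (PEND) ([LF‑II] p.385 L24 – p.386 L13, READ), the positions count (POS), the COVER (which classes are wild), and p621610's factor ∕
price ∕ epoch ∕ rate ∕ entropy letters — is a HYPOTHESIS produced by nobody, NOT asserted here; NO estimate of Bałaban's programme is proved; nothing of
Bałaban's asserted or instantiated (no `Provisos₁₃SepCoPH` tuple — K0⁷ OPEN); (V‑b) = (YG), (R′) untouched and UNPRINTED for d = 4; NE7 ∕ NE7b ∕ NE7c NOT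
PRINTED as two-run statements for d = 4 and NOT proved; N19 ∕ N20 NOT discharged; K3⁸ ∕ K3⁷ OPEN, not claimed; no summit statement is proved by this seat;
counts UNMOVED (typed 28∕28 · discharged 5∕27, A 5∕28).  One finite four-torus programme at fixed ε — NOT ℝ⁴, NOT infinite volume, NOT OS, NOT a mass gap,
NOT the Clay problem (R4 closes the conditional finite-𝕋⁴ rung `BalabanLadder.UV` only).  0 `def`; 0 `sorry`; standard axioms; no cite tags.
-/

noncomputable section

namespace Summit.QuantumFields.YangMills.BalabanUVNodes.N19WildMassLetterOfOverAgedCover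

open Finset
open Summit.QuantumFields.YangMills.BalabanUVNodes.N19ModellingLetterOfPeierlsDomination
  (modellingLetter_of_peierlsLetters wildMass_summable_of_peierlsLetters wildMass_summableOne_of_peierlsLetters)

/-! ## §1 The union bound: COVER ⇒ (BIRTH) with `C₀ = 1` on one weight system [folklore] -/

section Cover
variable {β : Type*} {π : Type*}

/-- [folklore] a relative mass is at most `1`: `A ≥ 0` on `T`, `W ⊆ T` ⇒ `Σ_W A ∕ Σ_T A ≤ 1` (junk-safe: `= 0` at total `0`). -/
theorem relMass_le_one (T W : Finset β) (A : β → ℝ) (hA : ∀ X ∈ T, 0 ≤ A X) (hW : W ⊆ T) :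
    (∑ X ∈ W, A X) / (∑ Y ∈ T, A Y) ≤ 1 := by
  have hle : ∑ X ∈ W, A X ≤ ∑ Y ∈ T, A Y := sum_le_sum_of_subset_of_nonneg hW fun X hX _ => hA X hX
  have hZ : 0 ≤ ∑ Y ∈ T, A Y := sum_nonneg hA
  rcases hZ.eq_or_lt with h0 | hpos
  · rw [← h0, div_zero]; exact zero_le_one
  · rwa [div_le_one hpos]

/-- **★ THE BIRTH LETTER FROM AN OVER-AGED COVER** [folklore union bound].  ONE finite class set `T` with weights `A ≥ 0`, a wild set `W ⊆ T`, birth depths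
`m < M` beyond a threshold `x`, birth positions `Pos m`, over-aged predicates `Over m p`; if every wild class is over-aged at SOME datum — `∀ X ∈ W, ∃ m < M,
x ≤ m ∧ ∃ p ∈ Pos m, Over m p X` (COVER) — then the relative wild mass is at most the sum over data of the relative over-aged masses under the SAME law:
`Σ_W A ∕ Σ_T A ≤ 1·Σ_{m<M} 𝟙[x ≤ m]·Σ_{p∈Pos m} (Σ_{X∈T, Over m p X} A X)∕(Σ_T A)` — LITERALLY the `hbirth` binder of p623281
`modellingLetter_of_peierlsLetters` with `𝒜 m p := T`, `A m p := A`, `C₀ := 1`. -/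
theorem relMass_le_sum_relOveraged_of_cover (T W : Finset β) (A : β → ℝ) (hA : ∀ X ∈ T, 0 ≤ A X) (hW : W ⊆ T)
    (x : ℝ) (M : ℕ) (Pos : ℕ → Finset π) (Over : ℕ → π → β → Prop) [∀ m p, DecidablePred (Over m p)]
    (hcover : ∀ X ∈ W, ∃ m ∈ range M, x ≤ (m : ℝ) ∧ ∃ p ∈ Pos m, Over m p X) :
    (∑ X ∈ W, A X) / (∑ Y ∈ T, A Y) ≤ 1 * ∑ m ∈ range M,
      (if x ≤ (m : ℝ) then ∑ p ∈ Pos m, (∑ X ∈ T with Over m p X, A X) / (∑ Y ∈ T, A Y) else 0) := by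
  -- the per-class majorant `F X := Σ_m 𝟙[x ≤ m] Σ_p 𝟙[Over m p X]·A X`
  set F : β → ℝ := fun X => ∑ m ∈ range M, (if x ≤ (m : ℝ) then ∑ p ∈ Pos m, (if Over m p X then A X else 0) else 0)
    with hF
  have hg0 : ∀ X ∈ T, ∀ m p, 0 ≤ (if Over m p X then A X else 0) := fun X hX m p => by
    split_ifs
    · exact hA X hX
    · exact le_rfl
  have hin0 : ∀ X ∈ T, ∀ m : ℕ, 0 ≤ (if x ≤ (m : ℝ) then ∑ p ∈ Pos m, (if Over m p X then A X else 0) else 0) :=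
    fun X hX m => by
      split_ifs
      · exact sum_nonneg fun p _ => hg0 X hX m p
      · exact le_rfl
  have hF0 : ∀ X ∈ T, 0 ≤ F X := fun X hX => sum_nonneg fun m _ => hin0 X hX m
  -- step 1: each wild class is dominated by its majorant (one term of a nonnegative double sum)
  have h1 : ∀ X ∈ W, A X ≤ F X := by
    intro X hXW
    have hXT : X ∈ T := hW hXW
    obtain ⟨m₀, hm₀, hxm₀, p₀, hp₀, hO⟩ := hcover X hXW
    calc A X = (if Over m₀ p₀ X then A X else 0) := by rw [if_pos hO]
      _ ≤ ∑ p ∈ Pos m₀, (if Over m₀ p X then A X else 0) :=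
          single_le_sum (f := fun p => if Over m₀ p X then A X else 0) (fun p _ => hg0 X hXT m₀ p) hp₀
      _ = (if x ≤ (m₀ : ℝ) then ∑ p ∈ Pos m₀, (if Over m₀ p X then A X else 0) else 0) := by rw [if_pos hxm₀]
      _ ≤ F X := single_le_sum (f := fun m : ℕ => if x ≤ (m : ℝ) then ∑ p ∈ Pos m, (if Over m p X then A X else 0) else 0)
          (fun m _ => hin0 X hXT m) hm₀
  -- step 2: sum over the wild set, enlarge to the class set
  have h2 : ∑ X ∈ W, A X ≤ ∑ X ∈ T, F X :=
    (sum_le_sum h1).trans (sum_le_sum_of_subset_of_nonneg hW fun X hX _ => hF0 X hX)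
  -- step 3: exchange the sums and refold the indicator into a filter
  have h3 : ∑ X ∈ T, F X
      = ∑ m ∈ range M, (if x ≤ (m : ℝ) then ∑ p ∈ Pos m, ∑ X ∈ T with Over m p X, A X else 0) := by
    rw [hF, sum_comm]
    refine sum_congr rfl fun m _ => ?_
    by_cases hxm : x ≤ (m : ℝ)
    · simp only [if_pos hxm]
      rw [sum_comm]
      refine sum_congr rfl fun p _ => ?_
      rw [sum_filter]
    · simp only [if_neg hxm, sum_const_zero]
  -- divide by the total (junk-safe at total 0)
  have hZ : 0 ≤ ∑ Y ∈ T, A Y := sum_nonneg hA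
  have h4 : (∑ X ∈ W, A X) / (∑ Y ∈ T, A Y)
      ≤ (∑ m ∈ range M, (if x ≤ (m : ℝ) then ∑ p ∈ Pos m, ∑ X ∈ T with Over m p X, A X else 0)) / (∑ Y ∈ T, A Y) :=
    div_le_div_of_nonneg_right (h2.trans_eq h3) hZ
  have h5 : (∑ m ∈ range M, (if x ≤ (m : ℝ) then ∑ p ∈ Pos m, ∑ X ∈ T with Over m p X, A X else 0)) / (∑ Y ∈ T, A Y)
      = ∑ m ∈ range M, (if x ≤ (m : ℝ) then ∑ p ∈ Pos m, (∑ X ∈ T with Over m p X, A X) / (∑ Y ∈ T, A Y) else 0) := by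
    rw [sum_div]
    refine sum_congr rfl fun m _ => ?_
    split_ifs
    · rw [sum_div]
    · rw [zero_div]
  rw [one_mul, ← h5]
  exact h4

end Cover

/-! ## §2 ONE `(K,t)`: (KR‑dc) + (PEND) + (POS) + COVER on ONE weight system ⇒ `hmodel` with `C₀ = 1` [folklore] -/

section OneKey
variable {α : Type*} [DecidableEq α] {π : Type*}

/-- **★★ THE MODELLING LETTER FROM THE COVER LETTERS, ONE WEIGHT SYSTEM** [folklore; = p623281 `modellingLetter_of_peierlsLetters` at `𝒜 m p := T`, `A m p := A`,
`C₀ := 1`, with (BIRTH) supplied by §1].  ONE finite DOWN-CLOSED class family `T` of histories (refresh-event sets) with weights `A ≥ 0` and the deficit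
factorisation `A X ≤ (Π_{j∈S} w m j)·A(X∖S)` for `S ⊆ X ∈ T` at every depth `m` ((KR‑dc), depth-indexed factors `w m ≥ 0` as in p623281), refresh events `U m`,
epochs `ℓ m`, budget `b`, positions `Pos m` with (POS) `#(Pos m) ≤ e^{Λm}`, over-aged predicates `Over m p` with (PEND) at over-age `m − b` inside `U m`, and a
wild set `W ⊆ T` COVERED by the data `(m,p)`, `x ≤ m < M`.  Conclusion — the `hmodel` binder of p621610's `wildMass_rate_of_refreshProcess` for the class law
itself: `Σ_W A∕Σ_T A ≤ 1·s` for every upper bound `s` of the partial sums `Σ_{m<M'} 𝟙[x ≤ m]·e^{Λm}·Σ_{S⊆U m, m−b ≤ Σ_S ℓ} Π_S w`. -/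
theorem modellingLetter_of_coverLetters (T : Finset (Finset α)) (A : Finset α → ℝ) (hA : ∀ X ∈ T, 0 ≤ A X)
    (hdown : ∀ X ∈ T, ∀ Y, Y ⊆ X → Y ∈ T)
    (U : ℕ → Finset α) (w ℓ : ℕ → α → ℝ) (hw0 : ∀ m j, 0 ≤ w m j)
    (hfac : ∀ m, ∀ X ∈ T, ∀ S, S ⊆ X → A X ≤ (∏ j ∈ S, w m j) * A (X \ S))
    {Λ : ℝ} (b x : ℝ) (Pos : ℕ → Finset π) (hpos : ∀ m, ((Pos m).card : ℝ) ≤ Real.exp (Λ * m))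
    (Over : ℕ → π → Finset α → Prop) [∀ m p, DecidablePred (Over m p)]
    (hpend : ∀ m p, ∀ X ∈ T, Over m p X → ∃ S, S ⊆ U m ∧ ((m : ℝ) - b ≤ ∑ j ∈ S, ℓ m j) ∧ S ⊆ X)
    (W : Finset (Finset α)) (hW : W ⊆ T) (M : ℕ)
    (hcover : ∀ X ∈ W, ∃ m ∈ range M, x ≤ (m : ℝ) ∧ ∃ p ∈ Pos m, Over m p X) :
    ∀ s : ℝ, (∀ M' : ℕ, ∑ m ∈ range M',
        (if x ≤ (m : ℝ) then Real.exp (Λ * m) *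
          ∑ S ∈ (U m).powerset with ((m : ℝ) - b ≤ ∑ j ∈ S, ℓ m j), ∏ j ∈ S, w m j else 0) ≤ s) →
      (∑ X ∈ W, A X) / (∑ Y ∈ T, A Y) ≤ 1 * s :=
  modellingLetter_of_peierlsLetters U w ℓ hw0 b x Pos hpos (fun _ _ => T) (fun _ _ => A) (fun _ _ => hA) (fun _ _ => hdown)
    (fun m _ => hfac m) Over hpend zero_le_one M
    (relMass_le_sum_relOveraged_of_cover T W A hA hW x M Pos Over hcover)

end OneKey

/-! ## §3 ALONG `K`: the wild-mass block of the road's K-summation for the class weights themselves [folklore] -/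

section AlongK
variable {α : Type*} [DecidableEq α] {π : Type*}

/-- **★★★ THE (V‑a) BINDER BLOCK FROM THE COVER LETTERS, AT THE CLASS WEIGHTS** [folklore; = p623281 `wildMass_summable_of_peierlsLetters` at
`wild K t := Σ_{W K t} A∕Σ_{T K} A`, `𝒜 K t m p := T K`, `A K t m p := A K t`, `C₀ := 1`, (BIRTH) supplied by §1, `wild ≤ 1` by `relMass_le_one`].
Per key `K` and source `t`: ONE down-closed class family `T K` with weights `A K t ≥ 0` and the deficit factorisation (KR‑dc) at every depth, refresh data
`U, w, ℓ, P` with p621610's letters (`0 ≤ w ≤ e^{−P}` on `U`, `θℓ ≤ P∕2`, entropy `Σ_U e^{−P∕2} ≤ Z₀ + ζm`; `θ ≥ 0`, `Λ + ζ < θ`, `κ₁(θ−Λ−ζ) > 2`), positions with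
(POS), over-aged predicates with (PEND) at over-age `m − b`, and wild sets `W K t ⊆ T K` COVERED by the data `(m,p)`, `b + κ₁ log K ≤ m < M K`, for `|t| ≤ l₀`,
`K ≥ 1`.  Conclusion: `∃ wm ≥ 0, Σ_K √wm_K < ∞, ∀ K t, |t| ≤ l₀ → Σ_{W K t} A∕Σ_{T K} A ≤ wm_K` — EXACTLY the `(wm, hwm, hwildA, hws)` binders of p627322
`affinityDefectLetter_of_tameTilt` ∕ p618979 `…_of_tameTilts` for run A (class index `ι := Finset α`).  ONE weight system per `(K,t)`; no `C₀`; no abstract `wild`. -/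
theorem classWildMass_summable_of_coverLetters {l₀ : ℝ} (T : ℕ → Finset (Finset α)) (A : ℕ → ℝ → Finset α → ℝ)
    (hA : ∀ K t, ∀ X ∈ T K, 0 ≤ A K t X) (hdown : ∀ K, ∀ X ∈ T K, ∀ Y, Y ⊆ X → Y ∈ T K)
    (W : ℕ → ℝ → Finset (Finset α)) (hW : ∀ K t, W K t ⊆ T K)
    {θ Λ ζ κ₁ Z₀ : ℝ} (b : ℝ) (hθ : 0 ≤ θ) (hΛθ : Λ + ζ < θ) (hκ : 2 < κ₁ * (θ - Λ - ζ))
    (U : ℕ → ℝ → ℕ → Finset α) (w ℓ P : ℕ → ℝ → ℕ → α → ℝ)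
    (hw0 : ∀ K t m j, 0 ≤ w K t m j)
    (hw : ∀ K t m, ∀ j ∈ U K t m, w K t m j ≤ Real.exp (-P K t m j))
    (hθP : ∀ K t m, ∀ j ∈ U K t m, θ * ℓ K t m j ≤ P K t m j / 2)
    (hZ : ∀ K t (m : ℕ), ∑ j ∈ U K t m, Real.exp (-(P K t m j / 2)) ≤ Z₀ + ζ * m)
    (hfac : ∀ K t m, ∀ X ∈ T K, ∀ S, S ⊆ X → A K t X ≤ (∏ j ∈ S, w K t m j) * A K t (X \ S))
    (Pos : ℕ → ℕ → Finset π) (hpos : ∀ K m, ((Pos K m).card : ℝ) ≤ Real.exp (Λ * m))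
    (Over : ℕ → ℝ → ℕ → π → Finset α → Prop) [∀ K t m p, DecidablePred (Over K t m p)]
    (hpend : ∀ K t m p, ∀ X ∈ T K, Over K t m p X → ∃ S, S ⊆ U K t m ∧ ((m : ℝ) - b ≤ ∑ j ∈ S, ℓ K t m j) ∧ S ⊆ X)
    (M : ℕ → ℕ)
    (hcover : ∀ (K : ℕ) (t : ℝ), |t| ≤ l₀ → 1 ≤ K → ∀ X ∈ W K t,
      ∃ m ∈ range (M K), b + κ₁ * Real.log (K : ℝ) ≤ (m : ℝ) ∧ ∃ p ∈ Pos K m, Over K t m p X) :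
    ∃ wm : ℕ → ℝ, (∀ K, 0 ≤ wm K) ∧ Summable (fun K => Real.sqrt (wm K)) ∧
      ∀ K t, |t| ≤ l₀ → (∑ X ∈ W K t, A K t X) / (∑ Y ∈ T K, A K t Y) ≤ wm K :=
  wildMass_summable_of_peierlsLetters (fun K t => (∑ X ∈ W K t, A K t X) / (∑ Y ∈ T K, A K t Y))
    (fun K t _ => relMass_le_one (T K) (W K t) (A K t) (hA K t) (hW K t)) b hθ hΛθ hκ zero_le_one U w ℓ P hw0 hw hθP hZ Pos hpos
    (fun K _ _ _ => T K) (fun K t _ _ => A K t) (fun K t _ _ => hA K t) (fun K _ _ _ => hdown K) (fun K t m _ => hfac K t m)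
    Over hpend M
    (fun K t ht hK => relMass_le_sum_relOveraged_of_cover (T K) (W K t) (A K t) (hA K t) (hW K t) _ (M K) (Pos K) (Over K t)
      (hcover K t ht hK))

/-- [folklore] **EXPONENT 1** (window-key-core's booked-mass letter (AC)): the same with `κ₁(θ−Λ−ζ) > 1` ⇒ `Summable wm` (p623281
`wildMass_summableOne_of_peierlsLetters` BY NAME). -/
theorem classWildMass_summableOne_of_coverLetters {l₀ : ℝ} (T : ℕ → Finset (Finset α)) (A : ℕ → ℝ → Finset α → ℝ)
    (hA : ∀ K t, ∀ X ∈ T K, 0 ≤ A K t X) (hdown : ∀ K, ∀ X ∈ T K, ∀ Y, Y ⊆ X → Y ∈ T K)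
    (W : ℕ → ℝ → Finset (Finset α)) (hW : ∀ K t, W K t ⊆ T K)
    {θ Λ ζ κ₁ Z₀ : ℝ} (b : ℝ) (hθ : 0 ≤ θ) (hΛθ : Λ + ζ < θ) (hκ : 1 < κ₁ * (θ - Λ - ζ))
    (U : ℕ → ℝ → ℕ → Finset α) (w ℓ P : ℕ → ℝ → ℕ → α → ℝ)
    (hw0 : ∀ K t m j, 0 ≤ w K t m j)
    (hw : ∀ K t m, ∀ j ∈ U K t m, w K t m j ≤ Real.exp (-P K t m j))
    (hθP : ∀ K t m, ∀ j ∈ U K t m, θ * ℓ K t m j ≤ P K t m j / 2)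
    (hZ : ∀ K t (m : ℕ), ∑ j ∈ U K t m, Real.exp (-(P K t m j / 2)) ≤ Z₀ + ζ * m)
    (hfac : ∀ K t m, ∀ X ∈ T K, ∀ S, S ⊆ X → A K t X ≤ (∏ j ∈ S, w K t m j) * A K t (X \ S))
    (Pos : ℕ → ℕ → Finset π) (hpos : ∀ K m, ((Pos K m).card : ℝ) ≤ Real.exp (Λ * m))
    (Over : ℕ → ℝ → ℕ → π → Finset α → Prop) [∀ K t m p, DecidablePred (Over K t m p)]
    (hpend : ∀ K t m p, ∀ X ∈ T K, Over K t m p X → ∃ S, S ⊆ U K t m ∧ ((m : ℝ) - b ≤ ∑ j ∈ S, ℓ K t m j) ∧ S ⊆ X)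
    (M : ℕ → ℕ)
    (hcover : ∀ (K : ℕ) (t : ℝ), |t| ≤ l₀ → 1 ≤ K → ∀ X ∈ W K t,
      ∃ m ∈ range (M K), b + κ₁ * Real.log (K : ℝ) ≤ (m : ℝ) ∧ ∃ p ∈ Pos K m, Over K t m p X) :
    ∃ wm : ℕ → ℝ, (∀ K, 0 ≤ wm K) ∧ Summable wm ∧
      ∀ K t, |t| ≤ l₀ → (∑ X ∈ W K t, A K t X) / (∑ Y ∈ T K, A K t Y) ≤ wm K :=
  wildMass_summableOne_of_peierlsLetters (fun K t => (∑ X ∈ W K t, A K t X) / (∑ Y ∈ T K, A K t Y))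
    (fun K t _ => relMass_le_one (T K) (W K t) (A K t) (hA K t) (hW K t)) b hθ hΛθ hκ zero_le_one U w ℓ P hw0 hw hθP hZ Pos hpos
    (fun K _ _ _ => T K) (fun K t _ _ => A K t) (fun K t _ _ => hA K t) (fun K _ _ _ => hdown K) (fun K t m _ => hfac K t m)
    Over hpend M
    (fun K t ht hK => relMass_le_sum_relOveraged_of_cover (T K) (W K t) (A K t) (hA K t) (hW K t) _ (M K) (Pos K) (Over K t)
      (hcover K t ht hK))

end AlongK

/-! ## §4 Toy (A6): the cover bound is tight [folklore] -/

section Toy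

/-- **TOY — ONE CLASS, ONE DATUM** (A6): class set `T = W = {()}` with weight `1`, one depth (`M = 1`), threshold `x = 0`, one position, over-aged := `True`:
the COVER holds and §1 returns `1∕1 ≤ 1·(1∕1)` — equality, so the union bound of §1 is tight and its hypothesis set is inhabited. -/
theorem toy_cover_tight :
    (∑ X ∈ ({()} : Finset Unit), (fun _ => (1:ℝ)) X) / (∑ Y ∈ ({()} : Finset Unit), (fun _ => (1:ℝ)) Y)
      ≤ 1 * ∑ m ∈ range 1, (if (0:ℝ) ≤ (m : ℝ) then
        ∑ p ∈ ({()} : Finset Unit), (∑ X ∈ ({()} : Finset Unit) with (fun (_ : ℕ) (_ : Unit) (_ : Unit) => True) m p X, (fun _ => (1:ℝ)) X)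
          / (∑ Y ∈ ({()} : Finset Unit), (fun _ => (1:ℝ)) Y) else 0) :=
  relMass_le_sum_relOveraged_of_cover ({()} : Finset Unit) {()} (fun _ => (1:ℝ)) (fun _ _ => zero_le_one) (Finset.Subset.refl _)
    0 1 (fun _ => {()}) (fun _ _ _ => True) fun X _ => ⟨0, by simp, by simp, (), by simp, trivial⟩

end Toy

end Summit.QuantumFields.YangMills.BalabanUVNodes.N19WildMassLetterOfOverAgedCover

end
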